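/-
Copyright (c) 2026 the pub-hodgecm-mathlib formalisation cell (harness21).  Prover seat hodgecm-mathlib-B-p04 (g47): LH4-plan (g6) WORD #3∕#5∕#8 brick (W3a)
«a conj-FIXED element in the unramified-or-square class of `L_w` is a square» at an inert-unramified DYADIC place; 2026-09-02.
-/
import Literature.NumberTheory.LocalFields.UnramifiedQuadraticFixedSquares        -- ★ FILE α: odd residue characteristic (`isSquare_of_galAdicCompletionMap_eq_of_even`), CM currency
import Literature.NumberTheory.LocalFields.WildQuadraticNormsExactness            -- ★ (X5 ⇐) `exists_mul_self_eq_one_add_four_mul` (Hensel for `X² + X − η`)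
import Literature.NumberTheory.LocalFields.ValuedPrincipalUnitsProP               -- ★ `lt_one_iff_le_exp_neg_one`
import Literature.NumberTheory.Automorphic.UnitaryLatticeTreeValencyInertPlace    -- ★ `Valued` residue plumbing: `exists_residueField_ringHom_of_v_eq`, `residueHom_galAdicCompletionMap_eq_pow_valued`, `fintypeCard_valuedResidueField_eq_sq_of_inert`
import Literature.NumberTheory.Automorphic.AdicCompletionIntegersAdicComplete     -- ★ `isAdicComplete_valuedMaximalIdeal_valuedInteger_adicCompletion`
import Literature.NumberTheory.Automorphic.AdicCompletionCompact                  -- ★ `finite_residueField_adicCompletion`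
import Literature.LinearAlgebra.Matrix.FiniteFieldHermitianAnisotropic            -- ★ `exists_frob_ne` (`Frob_q ≠ id` on a field of order `q²`)
import HarnessLib

/-!
# At an inert-UNRAMIFIED DYADIC place, a `σ_w`-fixed element of `L_w` in the «unramified-or-square» class `(1 + 4𝒪_w)·(L_w^×)²` is a SQUARE
(Serre, *Local Fields*, Ch. V §2, Ch. XIV §4; O'Meara §63A 63:3; Neukirch ANT II (4.3), (5.7): «an unramified extension of a local field is cyclic, so a
biquadratic `L_w(√a) ⊋ L_w ⊋ L⁺_v`, `a ∈ L⁺_v`, is never unramified over `L⁺_v`»)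

Topic `NumberTheory/LocalFields`; namespace `Literature.NumberTheory.LocalFields.UnramifiedQuadraticNorm` (sibling of ★ FILE α `UnramifiedQuadraticFixedSquares`, which is
the ODD residue characteristic).  THEOREMS ONLY (no definition, no instance, no notation, no named fact, no `sorry`); count-neutral; kernel lane `--supports
stmt-HodgeConjecture-24833`.  Cell `pub/hodgecm-mathlib` (D-0151), crux H413 = `stmt-HodgeConjecture-24833`, half A line LH4 (dyadic pay-down), LH4-plan (g6) WORD #3 (W3)
∕ WORD #5 ∕ WORD #8 layer **(W3a)**: «a conj-fixed `a` that lies in the unramified-or-square class of `L_w` — `∃ y, v_w(a·y² − 1) ≤ v_w(4)` (the hypothesis shape of ★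
`normGroup_of_valued_sub_one_le_four`) — is a SQUARE in `L_w`», at a place `v` inert-UNRAMIFIED in `L∕L⁺` with `v ∣ 2`; plus the any-characteristic head and the
consumer's contrapositive «a `σ_w`-fixed NON-square is not in the unramified-or-square class» (for `a ∼ disc χ_g` of a type-(2) class, ★ (W3b)
`Rogawski1990/FinCharpolyTwoDiscFixedClass`: `K₂ = L_w[g]` is biquadratic over `L⁺_v`, hence `K₂∕L_w` is RAMIFIED — at `v ∣ 2` the conductor of `L_w(√disc χ_g)∕L_w` is
`≥ 2`, at odd `v` `ord_w disc χ_g` is odd ★ `LocalIrreducibleTorusDiscriminantOdd`).  HONEST LABEL: HC_CM is proved only modulo the 7 printed citations (2 remaining named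
inputs: hLiu418 = stmt-HodgeConjecture-24832, h413 = stmt-HodgeConjecture-24833) until rung 0 closes; count-neutral (pays no organ, opens no road).

THE MATHEMATICS (a DESCENT proof; the Galois proof «`L_w(√a) ⊇ L⁺_v(√a)` would be an unramified biquadratic quartic over `L⁺_v`, but unramified extensions of a local
field are cyclic» needs quartic extensions the tree does not carry).  `K` complete, `v 2 < 1`, `|𝓀| = q²`, `σ` a valuation-preserving involution with `σ̄ = Frob_q` and a
`σ`-fixed uniformiser `ϖ` (§1; at `L_w`: `σ = σ_w`, `ϖ = ι_w(ϖ_v)`, §2).  Let `σa = a` and `d := a·y² ∈ 1 + 4𝒪`.  (i) `a(y² − (σy)²) = d − σd ∈ 4𝒪` and `v a·v(y)² = 1` give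
`v(y − σy) ≤ v 2·v y` (the factor-of-two step `(y − σy)(y + σy)`, `(y + σy) − (y − σy) = 2σy`).  (ii) DESCENT: an integral `u` with `σu ≡ u (mod ϖ^m)` is `≡ a₀ (mod ϖ^m)`
for a `σ`-FIXED `a₀` — induction on `m`, the step being residual: `ū ∈ Fix(Frob_q)`, `ē := ū^{q∕2}` has `ē·ē^q = ū`, so `e·σe` (`e` a lift of `ē`) is `σ`-fixed with residue
`ū` (§0∕§1).  Applied to `u := y·ϖ^{ord y}` at precision `ord 2`: `y = y₀(1 + 2s)` with `σy₀ = y₀`.  (iii) `b := a·y₀² = d∕(1 + 2s)²` is `σ`-fixed with `b ≡ 1 (mod 4)`.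
(iv) `β := (b − 1)∕4` is `σ`-fixed, so `β̄ ∈ Fix(Frob_q) = 𝔽_q`, and `X² + X = β̄` is solvable in `𝓀 = 𝔽_{q²}` (§0: `x = Σ_{i<f} γ^{2^i}`, `γ = θβ̄`, `θ + θ^q = 1`;
`Tr_{𝔽_{q²}∕𝔽₂} β̄ = 0`); Hensel (★ (X5 ⇐) `exists_mul_self_eq_one_add_four_mul`) makes `b`, hence `a = b∕y₀²`, a square.

## References
* [Serre1979] J.-P. Serre, *Local Fields*, GTM 67 (1979), Ch. V §2 Prop. 3 and Cor. (unramified quadratic: units are norms, `U ∕ U²`), Ch. XIV §4 (`K^× ∕ K^{×2}`, `p = 2`).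
* [Omeara1963] O. T. O'Meara, *Introduction to Quadratic Forms*, Grundlehren 117 (1963), §63A 63:3 (`1 + 4ρ` and the unramified quadratic extension), §63C 63:16.
* [NeukirchANT1999] J. Neukirch, *Algebraic Number Theory* (1999), Ch. II (4.3) (residue fields of completions), (5.7)–(5.8) (unramified extensions ↔ residue extensions, cyclic).
-/

set_option autoImplicit false

noncomputable section

open scoped Valued
open WithZero NumberField IsDedekindDomain
open Literature.NumberTheory.LocalFields Literature.NumberTheory.Automorphic Literature.NumberTheory.Automorphic.UnitaryLatticeTree
open Literature.NumberTheory.GaloisRepresentations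

namespace Literature.NumberTheory.LocalFields.UnramifiedQuadraticNorm

/-! ## §0 A finite field of order `q²` and characteristic `2`: `X² + X = β` is solvable for every `Frob_q`-fixed `β` -/

section FiniteField

variable {k : Type*} [Field k] [Fintype k] {q : ℕ}

/-- **Artin–Schreier over the `Frob_q`-fixed subfield.**  `k` a field with `q²` elements and `2 = 0`, `σ = Frob_q`; then every `σ`-fixed `β` is `x·x + x`
for some `x ∈ k`: with `θ := ω ∕ (ω + σω)` for any `σ`-moved `ω` (★ `exists_frob_ne`) one has `θ + σθ = 1`, so `γ := θβ` has `γ + γ^q = β`, and for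
`q = 2^f` the element `x := γ + γ² + γ⁴ + ⋯ + γ^{2^{f−1}}` satisfies `x² + x = γ^{2^f} + γ = β` (`Tr_{𝔽_{q²}∕𝔽₂} β = Tr_{𝔽_q∕𝔽₂}(2β) = 0`).
[cite: Serre1979, Ch. V §2 Prop. 3] [cite: NeukirchANT1999, Ch. II (4.3)] -/
theorem exists_mul_self_add_self_eq_of_frobenius_eq (hk : Fintype.card k = q ^ 2) (σ : k →+* k) (hσ : ∀ x, σ x = x ^ q)
    (h2 : (2 : k) = 0) {β : k} (hβ : σ β = β) : ∃ x : k, x * x + x = β := by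
  haveI : CharP k 2 := (CharP.charP_iff_prime_eq_zero Nat.prime_two).2 h2
  obtain ⟨n, -, hn⟩ := FiniteField.card k 2
  have hqn : q ∣ 2 ^ (n : ℕ) := ⟨q, by rw [← hn, hk, sq]⟩
  obtain ⟨f, -, hf⟩ : ∃ f ≤ (n : ℕ), q = 2 ^ f := (Nat.dvd_prime_pow Nat.prime_two).1 hqn
  obtain ⟨ω, hω⟩ := Literature.LinearAlgebra.Matrix.exists_frob_ne hk σ hσ
  have hden : ω + σ ω ≠ 0 := by
    intro h0
    apply hω
    have : σ ω = -ω := (neg_eq_of_add_eq_zero_right h0).symm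
    rw [this, neg_eq_iff_add_eq_zero, ← two_mul, h2, zero_mul]
  have hσσω : σ (σ ω) = ω := by
    rw [hσ, hσ, ← pow_mul, ← sq, ← hk, FiniteField.pow_card]
  set θ : k := ω / (ω + σ ω) with hθ
  have hθ1 : θ + σ θ = 1 := by
    rw [hθ, map_div₀, map_add, hσσω, add_comm (σ ω) ω, ← add_div, div_self hden]
  set γ : k := θ * β with hγ
  have hγβ : γ + σ γ = β := by
    rw [hγ, map_mul, hβ, ← add_mul, hθ1, one_mul]
  have step : ∀ j : ℕ, ∃ x : k, x * x + x = γ ^ (2 ^ j) + γ := by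
    intro j
    induction j with
    | zero => exact ⟨0, by rw [pow_zero, pow_one]; linear_combination (-γ) * h2⟩
    | succ j ih =>
      obtain ⟨x, hx⟩ := ih
      refine ⟨x + γ ^ (2 ^ j), ?_⟩
      have hG : γ ^ (2 ^ (j + 1)) = γ ^ (2 ^ j) * γ ^ (2 ^ j) := by rw [pow_succ, pow_mul, sq]
      rw [hG]
      linear_combination hx + (x * γ ^ (2 ^ j) + γ ^ (2 ^ j)) * h2
  obtain ⟨x, hx⟩ := step f
  refine ⟨x, ?_⟩
  rw [hx, ← hf, ← hσ, add_comm, hγβ]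

end FiniteField

/-! ## §1 A complete dyadic valued field with an «unramified» involution `σ` (`σ̄ = Frob_q`, `|𝓀| = q²`, a `σ`-fixed uniformiser): descent and the square theorem -/

section Generic

variable {K : Type*} [Field K] [Valued K ℤᵐ⁰] {σ : K →+* K}

/-- **The factor-of-two step**: `v(z·z − 1) ≤ v 4 ⇒ v(z − 1) ≤ v 2` for a unit-free reading `z = y ∕ y′`: if `v(y·y − y′·y′) ≤ v 4 · v(y)²` and `v y′ = v y`
then `v(y − y′) ≤ v 2 · v y` (were `v(y − y′) > v 2·v y`, the factor `y + y′ = (y − y′) + 2y′` would have the same value and the product would exceed `v 4·v(y)²`).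
[cite: Omeara1963, §63A 63:1–63:5] -/
theorem v_sub_le_two_mul_of_v_mul_self_sub_le {y y' : K} (hyy' : Valued.v y' = Valued.v y)
    (h : Valued.v (y * y - y' * y') ≤ Valued.v (4 : K) * (Valued.v y * Valued.v y)) :
    Valued.v (y - y') ≤ Valued.v (2 : K) * Valued.v y := by
  by_contra hlt
  rw [not_le] at hlt
  have h2y : Valued.v (2 * y') < Valued.v (y - y') := by rwa [map_mul, hyy']
  have hsum : Valued.v (y + y') = Valued.v (y - y') := by
    rw [show y + y' = (y - y') + 2 * y' by ring]
    exact Valuation.map_add_eq_of_lt_left _ h2y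
  have hprod : Valued.v (y * y - y' * y') = Valued.v (y - y') * Valued.v (y - y') := by
    rw [show y * y - y' * y' = (y - y') * (y + y') by ring, map_mul, hsum]
  rw [hprod, show (4 : K) = 2 * 2 by norm_num, map_mul] at h
  have hlt2 : Valued.v (2 : K) * Valued.v y * (Valued.v (2 : K) * Valued.v y) < Valued.v (y - y') * Valued.v (y - y') :=
    mul_lt_mul'' hlt hlt zero_le zero_le
  rw [mul_mul_mul_comm] at h
  exact (lt_irrefl _) (hlt2.trans_le h)

/-- `char 𝓀 = 2` at a dyadic place: the residue of `2` vanishes when `v 2 < 1`. [folklore] -/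
private theorem residue_two_eq_zero (h2v : Valued.v (2 : K) < 1) : (2 : 𝓀[K]) = 0 := by
  rw [← map_ofNat (IsLocalRing.residue 𝒪[K]) 2]
  exact (residue_eq_zero_iff_v_lt_one (K := K) (2 : 𝒪[K])).2 (by exact_mod_cast h2v)

/-- **RESIDUE DESCENT STEP** (`σ` an involution of the complete dyadic `K` with `σ̄ = Frob_q` on `𝓀`, `|𝓀| = q²`): if `u ∈ 𝒪` is `σ`-fixed modulo `𝔪` then
`u ≡ a (mod 𝔪)` for a `σ`-FIXED integral `a` — namely `a := e·σe` with `e := u^{q∕2}`: `ū^q = ū`, so `ē := ū^{q∕2}` has `ē² = ū`, `ē^q = ē`, and `ē·ē^q = ū`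
(`q` is even since `char 𝓀 = 2`).  [cite: Serre1979, Ch. V §2 Prop. 3] [cite: NeukirchANT1999, Ch. II (4.3)] -/
theorem exists_map_eq_self_v_sub_lt_one [Fintype 𝓀[K]] (hvσ : ∀ x, Valued.v (σ x) = Valued.v x) (hσσ : ∀ x, σ (σ x) = x)
    (σk : 𝓀[K] →+* 𝓀[K]) (hσk : ∀ x : 𝒪[K], IsLocalRing.residue 𝒪[K] ⟨σ x, map_mem_integer_of_v_eq hvσ x⟩ = σk (IsLocalRing.residue 𝒪[K] x))
    {q : ℕ} (hk : Fintype.card 𝓀[K] = q ^ 2) (hσq : ∀ y, σk y = y ^ q) (h2v : Valued.v (2 : K) < 1)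
    {u : K} (hu : Valued.v u ≤ 1) (hσu : Valued.v (σ u - u) < 1) :
    ∃ a : K, σ a = a ∧ Valued.v a ≤ 1 ∧ Valued.v (u - a) < 1 := by
  have h2k : (2 : 𝓀[K]) = 0 := residue_two_eq_zero h2v
  haveI : CharP 𝓀[K] 2 := (CharP.charP_iff_prime_eq_zero Nat.prime_two).2 h2k
  obtain ⟨n, -, hn⟩ := FiniteField.card 𝓀[K] 2
  obtain ⟨q', hq'⟩ : 2 ∣ q := by
    refine Nat.prime_two.dvd_of_dvd_pow (n := 2) ?_
    rw [← hk, hn]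
    exact dvd_pow_self 2 (PNat.ne_zero n)
  set U : 𝒪[K] := ⟨u, hu⟩ with hU
  set E1 : 𝒪[K] := U ^ q' with hE1
  set SE1 : 𝒪[K] := ⟨σ (E1 : K), map_mem_integer_of_v_eq hvσ E1⟩ with hSE1
  refine ⟨(E1 : K) * σ (E1 : K), by rw [map_mul, hσσ, mul_comm], (E1 * SE1).2, ?_⟩
  have hσU : IsLocalRing.residue 𝒪[K] ⟨σ u, map_mem_integer_of_v_eq hvσ U⟩ = IsLocalRing.residue 𝒪[K] U :=
    residue_eq_of_v_sub_lt_one hσu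
  have hfix : (IsLocalRing.residue 𝒪[K] U) ^ q = IsLocalRing.residue 𝒪[K] U := by
    rw [← hσq, ← hσk U]; exact hσU
  have hres : IsLocalRing.residue 𝒪[K] (E1 * SE1) = IsLocalRing.residue 𝒪[K] U := by
    rw [map_mul, hSE1, hσk E1, hσq, hE1, map_pow, ← pow_mul, show q' * q = q * q' from mul_comm _ _, pow_mul, hfix, ← pow_add,
      show q' + q' = q by omega, hfix]
  have h0 : IsLocalRing.residue 𝒪[K] (U - E1 * SE1) = 0 := by rw [map_sub, hres, sub_self]
  exact (residue_eq_zero_iff_v_lt_one _).1 h0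

/-- **DESCENT TO ϖ-ADIC PRECISION `m`** (`ϖ` a `σ`-FIXED uniformiser — the unramified situation): an integral `u` with `σ u ≡ u (mod ϖ^m)` is `≡ a (mod ϖ^m)` for a
`σ`-FIXED integral `a` (induction on `m`: the residue step ★ `exists_map_eq_self_v_sub_lt_one`, then `u = a₁ + ϖu₁` with `σu₁ ≡ u₁ (mod ϖ^{m−1})`).  «`(𝒪_w ∕ ϖ^m)^σ = 𝒪_v ∕ ϖ^m`»
for the unramified quadratic `L_w ∕ L⁺_v`. [cite: Serre1979, Ch. V §2 Prop. 3] [cite: NeukirchANT1999, Ch. II (4.3)] -/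
theorem exists_map_eq_self_v_sub_le_pow [Fintype 𝓀[K]] (hvσ : ∀ x, Valued.v (σ x) = Valued.v x) (hσσ : ∀ x, σ (σ x) = x)
    (σk : 𝓀[K] →+* 𝓀[K]) (hσk : ∀ x : 𝒪[K], IsLocalRing.residue 𝒪[K] ⟨σ x, map_mem_integer_of_v_eq hvσ x⟩ = σk (IsLocalRing.residue 𝒪[K] x))
    {q : ℕ} (hk : Fintype.card 𝓀[K] = q ^ 2) (hσq : ∀ y, σk y = y ^ q) (h2v : Valued.v (2 : K) < 1)
    {ϖ : K} (hϖ : Valued.v ϖ = exp (-1 : ℤ)) (hσϖ : σ ϖ = ϖ) (m : ℕ) :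
    ∀ {u : K}, Valued.v u ≤ 1 → Valued.v (σ u - u) ≤ Valued.v ϖ ^ m →
      ∃ a : K, σ a = a ∧ Valued.v a ≤ 1 ∧ Valued.v (u - a) ≤ Valued.v ϖ ^ m := by
  have hϖ0 : ϖ ≠ 0 := by
    intro h; rw [h, map_zero] at hϖ; exact exp_ne_zero hϖ.symm
  have hvϖ0 : Valued.v ϖ ≠ 0 := (Valuation.ne_zero_iff _).2 hϖ0
  have hϖ1 : Valued.v ϖ ≤ 1 := by rw [hϖ, ← exp_zero, exp_le_exp]; norm_num
  induction m with
  | zero =>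
    intro u hu _
    exact ⟨0, map_zero σ, by rw [map_zero]; exact zero_le, by rwa [sub_zero, pow_zero]⟩
  | succ m ih =>
    intro u hu hσu
    have hσu1 : Valued.v (σ u - u) < 1 := by
      refine lt_of_le_of_lt hσu ?_
      rw [pow_succ]
      exact (mul_le_of_le_one_left' (pow_le_one₀ zero_le hϖ1)).trans_lt (by rw [hϖ, ← exp_zero, exp_lt_exp]; norm_num)
    obtain ⟨a₁, hσa₁, ha₁, hua₁⟩ := exists_map_eq_self_v_sub_lt_one hvσ hσσ σk hσk hk hσq h2v hu hσu1
    have hua₁' : Valued.v (u - a₁) ≤ Valued.v ϖ := by rw [hϖ]; exact (lt_one_iff_le_exp_neg_one _).1 hua₁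
    set u₁ : K := (u - a₁) / ϖ with hu₁def
    have hu₁ : Valued.v u₁ ≤ 1 := by
      rw [hu₁def, map_div₀, div_le_one₀ (zero_lt_iff.2 hvϖ0)]; exact hua₁'
    have hσu₁ : Valued.v (σ u₁ - u₁) ≤ Valued.v ϖ ^ m := by
      have hre : σ u₁ - u₁ = (σ u - u) / ϖ := by
        rw [hu₁def, map_div₀, map_sub, hσa₁, hσϖ]; field_simp; ring
      rw [hre, map_div₀, div_le_iff₀ (zero_lt_iff.2 hvϖ0), ← pow_succ]
      exact hσu
    obtain ⟨a', hσa', ha', hu₁a'⟩ := ih hu₁ hσu₁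
    refine ⟨a₁ + ϖ * a', by rw [map_add, map_mul, hσa₁, hσϖ, hσa'], ?_, ?_⟩
    · refine (Valuation.map_add _ _ _).trans (max_le ha₁ ?_)
      rw [map_mul]; exact mul_le_one' hϖ1 ha'
    · have hre : u - (a₁ + ϖ * a') = ϖ * (u₁ - a') := by
        rw [hu₁def]; field_simp; ring
      rw [hre, map_mul, pow_succ']
      exact mul_le_mul_right hu₁a' _

/-- **THE SQUARE THEOREM (generic).**  `K` a complete dyadic valued field (`v 2 < 1`, `2 ≠ 0`) with finite residue field of order `q²`; `σ` a valuation-preserving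
involution of `K` reducing to `Frob_q` and fixing a uniformiser `ϖ` (the completion `L_w` at an inert-UNRAMIFIED dyadic place, `σ = σ_w`, `ϖ = ϖ_v`).  If `a` is
`σ`-FIXED and `a·y·y ∈ 1 + 4𝒪` for some `y ∈ K` — `a` lies in the «unramified-or-square» class `(1 + 4𝒪)·(K^×)²` of `K(√a)∕K` — then `a` IS A SQUARE in `K`.
DESCENT PROOF: (i) `v(y − σy) ≤ v 2·v y` (★ `v_sub_le_two_mul_of_v_mul_self_sub_le`: `y²·σd = (σy)²·d` for `d = a y²`); (ii) `y = y₀(1 + 2s)` with `σ y₀ = y₀`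
(★ `exists_map_eq_self_v_sub_le_pow` at precision `ord 2`); (iii) `b := a·y₀²` is `σ`-fixed with `b ≡ 1 (mod 4)`; (iv) `β := (b − 1)∕4` has `Frob_q`-fixed residue,
so `X² + X = β̄` is solvable in `𝓀` (★ `exists_mul_self_add_self_eq_of_frobenius_eq`) and Hensel (★ (X5 ⇐) `exists_mul_self_eq_one_add_four_mul`) makes `b`, hence
`a`, a square.  (Galois reading: `K(√a) ⊇ K^σ(√a)` would be an unramified BIQUADRATIC extension of `K^σ` — but unramified extensions are cyclic.)
[cite: Serre1979, Ch. V §2 Prop. 3; Ch. XIV §4] [cite: Omeara1963, §63A 63:3] [cite: NeukirchANT1999, Ch. II (4.3), (5.7)] -/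
theorem isSquare_of_map_eq_self_of_v_mul_mul_self_sub_one_le_four [IsAdicComplete 𝓂[K] 𝒪[K]] [Fintype 𝓀[K]]
    (hvσ : ∀ x, Valued.v (σ x) = Valued.v x) (hσσ : ∀ x, σ (σ x) = x)
    (σk : 𝓀[K] →+* 𝓀[K]) (hσk : ∀ x : 𝒪[K], IsLocalRing.residue 𝒪[K] ⟨σ x, map_mem_integer_of_v_eq hvσ x⟩ = σk (IsLocalRing.residue 𝒪[K] x))
    {q : ℕ} (hk : Fintype.card 𝓀[K] = q ^ 2) (hσq : ∀ y, σk y = y ^ q) (h2 : (2 : K) ≠ 0) (h2v : Valued.v (2 : K) < 1)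
    {ϖ : K} (hϖ : Valued.v ϖ = exp (-1 : ℤ)) (hσϖ : σ ϖ = ϖ)
    {a y : K} (hσa : σ a = a) (hy : Valued.v (a * (y * y) - 1) ≤ Valued.v (4 : K)) : IsSquare a := by
  have hv2 : Valued.v (2 : K) ≠ 0 := (Valuation.ne_zero_iff _).2 h2
  have h4 : (4 : K) = 2 * 2 := by norm_num
  have h40 : (4 : K) ≠ 0 := by rw [h4]; exact mul_ne_zero h2 h2
  have hv4 : Valued.v (4 : K) < 1 := by rw [h4, map_mul]; exact (mul_le_of_le_one_left' h2v.le).trans_lt h2v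
  have hσ4 : σ 4 = 4 := map_ofNat σ 4
  have hϖ0 : ϖ ≠ 0 := by
    intro h; rw [h, map_zero] at hϖ; exact exp_ne_zero hϖ.symm
  set d : K := a * (y * y) with hd
  have hd1 : Valued.v (d - 1) < 1 := lt_of_le_of_lt hy hv4
  have hvd : Valued.v d = 1 := valued_eq_one_of_valued_sub_one_lt_one' hd1
  have hy0 : y ≠ 0 := by
    rintro rfl
    rw [hd, mul_zero, mul_zero, map_zero] at hvd
    exact zero_ne_one hvd
  have hvy0 : Valued.v y ≠ 0 := (Valuation.ne_zero_iff _).2 hy0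
  have ha0 : a ≠ 0 := by
    rintro rfl
    rw [hd, zero_mul, map_zero] at hvd
    exact zero_ne_one hvd
  have hσd : σ d = a * (σ y * σ y) := by rw [hd, map_mul, map_mul, hσa]
  have hdiff : Valued.v (y - σ y) ≤ Valued.v (2 : K) * Valued.v y := by
    refine v_sub_le_two_mul_of_v_mul_self_sub_le (hvσ y) ?_
    have hre : y * y - σ y * σ y = (d - σ d) * a⁻¹ := by rw [hσd, hd]; field_simp
    have hva : Valued.v a * (Valued.v y * Valued.v y) = 1 := by rw [← map_mul, ← map_mul, ← hd]; exact hvd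
    have hdd : Valued.v (d - σ d) ≤ Valued.v (4 : K) := by
      rw [show d - σ d = (d - 1) - (σ d - 1) by ring]
      refine (Valuation.map_sub _ _ _).trans (max_le hy ?_)
      rw [show σ d - 1 = σ (d - 1) by rw [map_sub, map_one], hvσ]; exact hy
    rw [hre, map_mul, map_inv₀]
    calc Valued.v (d - σ d) * (Valued.v a)⁻¹ ≤ Valued.v (4 : K) * (Valued.v a)⁻¹ := mul_le_mul_left hdd _
      _ = Valued.v (4 : K) * (Valued.v y * Valued.v y) := by rw [inv_eq_of_mul_eq_one_right hva]
  set n : ℤ := log (Valued.v y) with hn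
  have hvyn : Valued.v y = exp n := by rw [hn, exp_log hvy0]
  set u : K := y * ϖ ^ n with hudef
  have hvϖn : Valued.v (ϖ ^ n) = exp (-n) := by rw [map_zpow₀, hϖ, ← exp_zsmul, zsmul_eq_mul, Int.cast_id, mul_neg_one]
  have hvu : Valued.v u = 1 := by rw [hudef, map_mul, hvyn, hvϖn, ← exp_add, add_neg_cancel, exp_zero]
  have hσϖn : σ (ϖ ^ n) = ϖ ^ n := by rw [map_zpow₀, hσϖ]
  have hϖn0 : ϖ ^ n ≠ 0 := zpow_ne_zero n hϖ0
  obtain ⟨e, he⟩ : ∃ e : ℕ, Valued.v (2 : K) = Valued.v ϖ ^ e := by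
    have hℓ : Valued.v (2 : K) = exp (log (Valued.v (2 : K))) := (exp_log hv2).symm
    have hℓ0 : log (Valued.v (2 : K)) ≤ 0 := by rw [log_le_iff_le_exp hv2, exp_zero]; exact h2v.le
    refine ⟨(-log (Valued.v (2 : K))).toNat, ?_⟩
    rw [hϖ, ← exp_nsmul, nsmul_eq_mul, mul_neg_one, Int.toNat_of_nonneg (by omega), neg_neg]
    exact hℓ
  have hσu : Valued.v (σ u - u) ≤ Valued.v ϖ ^ e := by
    have hre : σ u - u = -((y - σ y) * ϖ ^ n) := by rw [hudef, map_mul, hσϖn]; ring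
    rw [hre, Valuation.map_neg, map_mul, hvϖn, ← he]
    calc Valued.v (y - σ y) * exp (-n) ≤ Valued.v (2 : K) * Valued.v y * exp (-n) := mul_le_mul_left hdiff _
      _ = Valued.v (2 : K) := by rw [hvyn, mul_assoc, ← exp_add, add_neg_cancel, exp_zero, mul_one]
  obtain ⟨a₀, hσa₀, ha₀, hua₀⟩ := exists_map_eq_self_v_sub_le_pow hvσ hσσ σk hσk hk hσq h2v hϖ hσϖ e hvu.le hσu
  rw [← he] at hua₀
  have hva₀ : Valued.v a₀ = 1 := by
    have hlt : Valued.v (u - a₀) < Valued.v u := by rw [hvu]; exact hua₀.trans_lt h2v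
    rw [show a₀ = u - (u - a₀) by ring, Valuation.map_sub_eq_of_lt_left _ hlt, hvu]
  have ha₀0 : a₀ ≠ 0 := fun h => by rw [h, map_zero] at hva₀; exact zero_ne_one hva₀
  set y₀ : K := a₀ * (ϖ ^ n)⁻¹ with hy₀def
  have hσy₀ : σ y₀ = y₀ := by rw [hy₀def, map_mul, map_inv₀, hσa₀, hσϖn]
  have hy₀0 : y₀ ≠ 0 := mul_ne_zero ha₀0 (inv_ne_zero hϖn0)
  set s : K := (u - a₀) / (2 * a₀) with hsdef
  have hvs : Valued.v s ≤ 1 := by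
    rw [hsdef, map_div₀, map_mul, hva₀, mul_one, div_le_one₀ (zero_lt_iff.2 hv2)]; exact hua₀
  have hyy₀ : y = y₀ * (1 + 2 * s) := by
    rw [hy₀def, hsdef, hudef]; field_simp; ring
  set b : K := a * (y₀ * y₀) with hbdef
  have hσb : σ b = b := by rw [hbdef, map_mul, map_mul, hσa, hσy₀]
  set m₁ : K := (1 + 2 * s) * (1 + 2 * s) with hm₁def
  have hdm : d = b * m₁ := by rw [hd, hbdef, hm₁def, hyy₀]; ring
  have hm₁1 : Valued.v (m₁ - 1) ≤ Valued.v (4 : K) := by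
    rw [show m₁ - 1 = 4 * (s * (1 + s)) by rw [hm₁def]; ring, map_mul]
    refine mul_le_of_le_one_right' ?_
    rw [map_mul]
    exact mul_le_one' hvs ((Valuation.map_add _ _ _).trans (max_le (le_of_eq (Valuation.map_one _)) hvs))
  have hvm₁ : Valued.v m₁ = 1 := valued_eq_one_of_valued_sub_one_lt_one' (hm₁1.trans_lt hv4)
  have hm₁0 : m₁ ≠ 0 := fun h => by rw [h, map_zero] at hvm₁; exact zero_ne_one hvm₁
  have hb1 : Valued.v (b - 1) ≤ Valued.v (4 : K) := by
    have hre : b - 1 = ((d - 1) - (m₁ - 1)) * m₁⁻¹ := by rw [hdm]; field_simp; ring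
    rw [hre, map_mul, map_inv₀, hvm₁, inv_one, mul_one]
    exact (Valuation.map_sub _ _ _).trans (max_le hy hm₁1)
  set β : K := (b - 1) / 4 with hβdef
  have hvβ : Valued.v β ≤ 1 := by
    rw [hβdef, map_div₀, div_le_one₀ (zero_lt_iff.2 ((Valuation.ne_zero_iff _).2 h40))]; exact hb1
  have hσβ : σ β = β := by rw [hβdef, map_div₀, map_sub, hσb, map_one, hσ4]
  have hbβ : 1 + 4 * β = b := by rw [hβdef]; field_simp; ring
  set B : 𝒪[K] := ⟨β, hvβ⟩ with hB
  have hfixB : σk (IsLocalRing.residue 𝒪[K] B) = IsLocalRing.residue 𝒪[K] B := by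
    rw [← hσk B]; congr 1; exact Subtype.ext hσβ
  have h2k : (2 : 𝓀[K]) = 0 := residue_two_eq_zero h2v
  obtain ⟨xk, hxk⟩ := exists_mul_self_add_self_eq_of_frobenius_eq hk σk hσq h2k hfixB
  obtain ⟨X, hX⟩ := IsLocalRing.residue_surjective xk
  have hρ : Valued.v ((X : K) * X + X - β) < 1 := by
    have h0 : IsLocalRing.residue 𝒪[K] (X * X + X - B) = 0 := by rw [map_sub, map_add, map_mul, hX, hxk, sub_self]
    exact (residue_eq_zero_iff_v_lt_one _).1 h0
  obtain ⟨r, hr⟩ := exists_mul_self_eq_one_add_four_mul h2v X.2 hρ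
  rw [hbβ] at hr
  exact ⟨r / y₀, by rw [div_mul_div_comm, hr, hbdef, mul_div_cancel_right₀ _ (mul_ne_zero hy₀0 hy₀0)]⟩

end Generic

/-! ## §2 The completion `L_w` of a CM field `L` at a place `v` of `L⁺` INERT-UNRAMIFIED in `L` with `v ∣ 2`: `σ_w`-fixed elements of the unramified-or-square class are squares -/

section CM

variable (L : Type) [Field L] [NumberField L] [IsCMField L] (v : HeightOneSpectrum (𝓞 ↥(maximalRealSubfield L)))
  (w : UnitaryGroup.PlacesOver L v) (hw : IsCMField.complexConj L • w.1 = w.1)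

include hw in
/-- **AT AN INERT-UNRAMIFIED DYADIC PLACE, A `σ_w`-FIXED `a ∈ L_w` WITH `a·y·y ≡ 1 (mod 4𝒪_w)` FOR SOME `y ∈ L_w` IS A SQUARE IN `L_w`.**  (`v` unramified in `L`,
`σ_L • w = w`, `|2|_w < 1`; the hypothesis says `a ∈ (1 + 4𝒪_w)·(L_w^×)²`, the norm-one∕unramified class of ★ `normGroup_of_valued_sub_one_le_four`.)  The generic ★
`isSquare_of_map_eq_self_of_v_mul_mul_self_sub_one_le_four` docked with `σ = σ_w` (★ `valued_galAdicCompletionMap`, `galAdicCompletionMap_galAdicCompletionMap_self`),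
`σ̄_w = Frob_{q_v}` (★ `residueHom_galAdicCompletionMap_eq_pow_valued`), `|𝓀[L_w]| = q_v²` (★ `fintypeCard_valuedResidueField_eq_sq_of_inert`), the `σ_w`-fixed
uniformiser `ι_w(ϖ_v)` (★ `valued_toPlace_uniformizer`, `galAdicCompletionMap_toPlace_self`) and completeness ★ `isAdicComplete_valuedMaximalIdeal_valuedInteger_adicCompletion`.
Galois reading: `L_w(√a) ⊇ L⁺_v(√a)` unramified biquadratic over `L⁺_v` is impossible. [cite: Serre1979, Ch. V §2 Prop. 3; Ch. XIV §4] [cite: Omeara1963, §63A 63:3]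
[cite: NeukirchANT1999, Ch. II (4.3), (5.7)] -/
theorem isSquare_of_galAdicCompletionMap_eq_of_valued_mul_sq_sub_one_le_four (hunr : Algebra.IsUnramifiedIn (𝓞 L) v.asIdeal)
    (h2v : Valued.v (2 : w.1.adicCompletion L) < 1) {a y : w.1.adicCompletion L}
    (hσa : galAdicCompletionMap (L := L) (IsCMField.complexConj L) hw a = a)
    (hy : Valued.v (a * (y * y) - 1) ≤ Valued.v (4 : w.1.adicCompletion L)) : IsSquare a := by
  haveI := Literature.NumberTheory.Automorphic.isAdicComplete_valuedMaximalIdeal_valuedInteger_adicCompletion L w.1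
  haveI : Finite 𝓀[w.1.adicCompletion L] := Literature.NumberTheory.Automorphic.finite_residueField_adicCompletion L w.1
  letI : Fintype 𝓀[w.1.adicCompletion L] := Fintype.ofFinite _
  have hc : IsCMField.complexConj L ≠ 1 := IsCMField.complexConj_ne_one L
  have hcc : IsCMField.complexConj L * IsCMField.complexConj L = 1 := AlgEquiv.ext fun y => IsCMField.complexConj_apply_apply L y
  have hvσ : ∀ x, Valued.v (galAdicCompletionMap (L := L) (IsCMField.complexConj L) hw x) = Valued.v x :=
    fun x => valued_galAdicCompletionMap (L := L) (IsCMField.complexConj L) hw x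
  have hσσ : ∀ x, galAdicCompletionMap (L := L) (IsCMField.complexConj L) hw (galAdicCompletionMap (L := L) (IsCMField.complexConj L) hw x) = x :=
    fun x => Liu2021.galAdicCompletionMap_galAdicCompletionMap_self _ L (IsCMField.complexConj L) hcc hw x
  obtain ⟨σk, hσk⟩ := exists_residueField_ringHom_of_v_eq (K := w.1.adicCompletion L) hvσ
  have hσq := residueHom_galAdicCompletionMap_eq_pow_valued (IsCMField.complexConj L) v hc hunr w hw σk hσk
  have hk := fintypeCard_valuedResidueField_eq_sq_of_inert (IsCMField.complexConj L) v hc hunr w hw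
  have h2 : (2 : w.1.adicCompletion L) ≠ 0 := by
    rw [show (2 : w.1.adicCompletion L) = algebraMap L (w.1.adicCompletion L) 2 by rw [map_ofNat]]
    exact (_root_.map_ne_zero (algebraMap L (w.1.adicCompletion L))).2 two_ne_zero
  exact isSquare_of_map_eq_self_of_v_mul_mul_self_sub_one_le_four hvσ hσσ σk hσk hk hσq h2 h2v
    (UnitaryGroup.valued_toPlace_uniformizer L v w hunr) (UnitaryGroup.galAdicCompletionMap_toPlace_self L v w hw _) hσa hy

include hw in
/-- **ANY RESIDUE CHARACTERISTIC: a `σ_w`-fixed `a` in the unramified-or-square class of `L_w` is a square** (`v` inert-unramified in `L`): the class is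
`{a : ∃ y, v_w(a·y·y) = 1 ∧ v_w(a·y·y − 1) ≤ v_w(4)}` — at `|2|_w = 1` the second clause is implied by the first (and the bare `∃ y, v_w(a·y·y − 1) ≤ v_w 4`
would be witnessed by `y = 0`), and the statement is ★ FILE α `isSquare_of_galAdicCompletionMap_eq_of_even` (a `σ_w`-fixed element of even order is a square); at
`|2|_w < 1` the first clause is implied by the second and the statement is ★ `isSquare_of_galAdicCompletionMap_eq_of_valued_mul_sq_sub_one_le_four`.
[cite: Serre1979, Ch. V §2 Prop. 3; Ch. XIV §4] [cite: Omeara1963, §63A 63:3; §63C 63:16] [cite: NeukirchANT1999, Ch. II (4.3), (5.7)] -/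
theorem isSquare_of_galAdicCompletionMap_eq_of_valued_mul_sq_eq_one (hunr : Algebra.IsUnramifiedIn (𝓞 L) v.asIdeal)
    {a y : w.1.adicCompletion L} (hσa : galAdicCompletionMap (L := L) (IsCMField.complexConj L) hw a = a)
    (h1 : Valued.v (a * (y * y)) = 1) (h4 : Valued.v (a * (y * y) - 1) ≤ Valued.v (4 : w.1.adicCompletion L)) : IsSquare a := by
  by_cases h2v : Valued.v (2 : w.1.adicCompletion L) < 1
  · exact isSquare_of_galAdicCompletionMap_eq_of_valued_mul_sq_sub_one_le_four L v w hw hunr h2v hσa h4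
  · have h2 : Valued.v (2 : w.1.adicCompletion L) = 1 := by
      refine le_antisymm ?_ (not_lt.1 h2v)
      rw [show (2 : w.1.adicCompletion L) = 1 + 1 by norm_num]
      exact (Valuation.map_add _ _ _).trans (by rw [Valuation.map_one, max_self])
    have ha0 : a ≠ 0 := by
      rintro rfl
      rw [zero_mul, map_zero] at h1
      exact zero_ne_one h1
    have hy0 : y ≠ 0 := by
      rintro rfl
      rw [mul_zero, mul_zero, map_zero] at h1
      exact zero_ne_one h1
    have hva : Valued.v a ≠ 0 := (Valuation.ne_zero_iff _).2 ha0
    have hvy : Valued.v y ≠ 0 := (Valuation.ne_zero_iff _).2 hy0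
    have heven : Even (log (Valued.v a)) := by
      refine ⟨-log (Valued.v y), ?_⟩
      have h := congrArg log h1
      rw [map_mul, map_mul, log_mul hva (mul_ne_zero hvy hvy), log_mul hvy hvy, log_one] at h
      omega
    exact isSquare_of_galAdicCompletionMap_eq_of_even L v w hw hunr h2 ha0 hσa heven

include hw in
/-- **CONSUMER SHAPE (LH4 M3∕M4): a `σ_w`-fixed NON-SQUARE of `L_w` is NOT in the unramified-or-square class** — for every `y` with `v_w(a·y·y) = 1` one has
`v_w(4) < v_w(a·y·y − 1)`; i.e. `L_w(√a)∕L_w` is RAMIFIED: conductor `f ≥ 2` at `v ∣ 2` (read through ★ `conductor_exists_of_forall_mul_self_ne`), `ord_w a` odd at odd `v`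
(★ `odd_log_valued_of_not_isSquare`).  For `a ∼ disc χ_g` of a type-(2) class (★ `FinCharpolyTwoDiscFixedClass`) this is «`K₂ = L_w[g]` biquadratic over `L⁺_v` ⇒
`K₂∕L_w` ramified». [cite: Serre1979, Ch. V §2 Prop. 3; Ch. XIV §4] [cite: Omeara1963, §63A 63:3] [cite: NeukirchANT1999, Ch. II (4.3), (5.7)] -/
theorem valued_four_lt_valued_mul_sq_sub_one_of_not_isSquare (hunr : Algebra.IsUnramifiedIn (𝓞 L) v.asIdeal)
    {a : w.1.adicCompletion L} (hσa : galAdicCompletionMap (L := L) (IsCMField.complexConj L) hw a = a) (hns : ¬ IsSquare a)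
    {y : w.1.adicCompletion L} (h1 : Valued.v (a * (y * y)) = 1) :
    Valued.v (4 : w.1.adicCompletion L) < Valued.v (a * (y * y) - 1) :=
  lt_of_not_ge fun h4 => hns (isSquare_of_galAdicCompletionMap_eq_of_valued_mul_sq_eq_one L v w hw hunr hσa h1 h4)

end CM

end Literature.NumberTheory.LocalFields.UnramifiedQuadraticNorm

end
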